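import Mathlib.LinearAlgebra.Matrix.Symmetric
import Literature.Computability.AlgebraicComplexity.DeterminantalComplexity
import HarnessLib

/-!
# Symmetric determinantal representation of the generic determinant (named fact, D-0014)

B. Grenet, E. Kaltofen, P. Koiran, N. Portier, *Symmetric determinantal representation of
formulas and weakly skew circuits*, in: Randomization, Relaxation, and Complexity in Polynomial
Equation Solving, Contemp. Math. **556** (2011) 61–96 (arXiv:1007.3804, read for this file as
`paper:arxiv-1007.3804`). The paper shows that every formula / weakly-skew circuit has a
SYMMETRIC affine determinantal representation of linear size ("Theorem 4. Let `f` be a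
polynomial computable by a weakly-skew circuit of fat size `m`. Then there exists a symmetric
matrix `A` of dimensions at most `2m+1` whose entries are inputs of the circuit and elements
from `{0,1,-1,1/2}` such that `f = det A`"), "valid for any field of characteristic different
from `2`" (§1), and records, with proof, the following sharper statement for the determinant
itself, communicated by Mahajan and Nimbhorkar (§4, after Theorem 4):

> "**Theorem 5** (Meena Mahajan and Prajakta Nimbhorkar). For every `n` there is a symmetric
> matrix `M` of dimensions `4n³+7` and entries in `{x_{i,j} | 1 ≤ i,j ≤ n} ∪ {0; 1; -1; 1/2}`
> such that `DET_n = det M`."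

(Proof there: symmetrise the Mahajan–Vinay algebraic branching program for `DET_n` — `2n³+3`
vertices, `n+1` layers — by duplicating vertices, `4n³+6` vertices in `2n+2` layers, then one
extra vertex.)

## Rendering

* `DET_n` is the tree's generic determinant `detPoly (Fin n) k = det (Matrix.mvPolynomialX …)`
  in the `n²` variables `X (i, j)` (`StandardFamilies.lean`).
* "entries in `{x_{i,j}} ∪ {0; 1; -1; 1/2}`": every entry of `M` is a variable `X ij` or one of
  the four constants `0, 1, -1, C 2⁻¹` — in particular affine, so `M` is a symmetric affine
  determinantal representation (`IsAffineDetRepr`, `DeterminantalComplexity.lean`) of `DET_n` of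
  size `4n³+7`, and substituting the affine entries of any size-`n` affine determinantal
  representation of a polynomial `f` for the `x_{i,j}` gives a symmetric one of `f` of size
  `4n³+7` (the route item `Summit.ValiantsHypothesis.ValiantsHypothesis.Theses.SymPencil.SdcOfDc`
  = this fact ∘ `MvPolynomial.aeval` + `RingHom.map_det`).
* Field of characteristic `≠ 2` (§1: "Our constructions are valid for any field of
  characteristic different from `2`"; the constant `1/2` is used): `∀ k, Field k, (2 : k) ≠ 0`.
* The dimension is exactly `4n³+7` as printed (no `O(·)`).

Deliberately NOT here: Theorems 2–4 (formulas of green size `e` ↦ symmetric matrices of size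
`2e+1` / weakly-skew circuits of fat size `m` ↦ `2m+1`; the tree has no notion of weakly-skew
circuit or green/fat size yet), the characteristic-`2` obstructions (Theorems 6–9), and the
comparison with Quarez's construction (§4.3).

## References

* [GrenetEtAl2011] Grenet–Kaltofen–Koiran–Portier, Contemp. Math. 556 (2011) 61–96
  = arXiv:1007.3804: §1 (characteristic `≠ 2`), Theorem 4 (weakly-skew circuits), Theorem 5
  (Mahajan–Nimbhorkar, `DET_n` symmetric of size `4n³+7`, with proof).
* [MignonRessayre2004] for affine determinantal representations (via
  `DeterminantalComplexity.lean`).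
-/

noncomputable section

namespace Literature.Computability.AlgebraicComplexity

open MvPolynomial

/-- **Grenet–Kaltofen–Koiran–Portier 2011, Theorem 5 (Mahajan–Nimbhorkar): the generic
determinant is a SYMMETRIC determinant of size `4n³ + 7`.** "For every `n` there is a symmetric
matrix `M` of dimensions `4n³+7` and entries in `{x_{i,j} | 1 ≤ i,j ≤ n} ∪ {0; 1; -1; 1/2}`
such that `DET_n = det M`", over any field of characteristic different from `2` (§1).
Rendered: for every field `k` with `(2 : k) ≠ 0` and every `n`, a symmetric matrix over
`MvPolynomial (Fin n × Fin n) k` indexed by `Fin (4 n³ + 7)` whose entries are variables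
`X ij` or constants `0, 1, -1, C 2⁻¹`, with determinant `detPoly (Fin n) k`. Grounds
`Summit.ValiantsHypothesis.ValiantsHypothesis.Theses.SymPencil.SdcOfDc` (substitute an affine
representation of `f` for the variables). Theorem number as in arXiv:1007.3804.
[cite: GrenetEtAl2011, Thm 5] -/
def GKKP2011_detPoly_symmetric : Prop :=
  ∀ (k : Type) [Field k], (2 : k) ≠ 0 → ∀ n : ℕ,
    ∃ M : Matrix (Fin (4 * n ^ 3 + 7)) (Fin (4 * n ^ 3 + 7)) (MvPolynomial (Fin n × Fin n) k),
      Matrix.IsSymm M ∧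
      (∀ a b, (∃ ij : Fin n × Fin n, M a b = X ij) ∨ M a b = 0 ∨ M a b = 1 ∨ M a b = -1 ∨
        M a b = C (2⁻¹ : k)) ∧
      M.det = detPoly (Fin n) k

end Literature.Computability.AlgebraicComplexity

end
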